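import Mathlib.Analysis.InnerProductSpace.Basic
import Mathlib.Analysis.Normed.Operator.Basic
import Mathlib.Analysis.SpecificLimits.Basic
import HarnessLib

/-!
# Uniform convergence of transfer-operator ratios under power iteration with a gap

Topic `Literature/Analysis/OperatorTheory`; companion of `PositivityImprovingSpectralGap.lean`, whose
conclusion `‖Aⁿ g - ‖A‖ⁿ ⟪φ, g⟫ φ‖ ≤ θⁿ ‖g‖` (`θ < ‖A‖`) is the hypothesis `hpow` here. Pure
real-Hilbert-space bookkeeping (Mathlib only, everything PROVED, no definitions):

* `abs_inner_apply_sub_inner_apply_le` — `|⟪x, My⟫ - ⟪x', My'⟫| ≤ ‖M‖ (‖x-x'‖‖y‖ + ‖x'‖‖y-y'‖)`;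
* `abs_add_div_add_sub_div_le` — `|(a+e₁)/(b+e₂) - a/b| ≤ 2(|e₁| + (|a|/b)|e₂|)/b` for `|e₂| ≤ b/2`;
* `exists_forall_abs_ratio_sub_lt` (**main**) — if `‖Aⁿ g - λ₀ⁿ⟪φ,g⟫φ‖ ≤ θⁿ‖g‖` with `0 ≤ θ < λ₀`,
  `k : X → E` is bounded and `⟪φ, M₁φ⟫ > 0`, then for all `δ, ε > 0` there is `N₀` such that for
  `n ≥ N₀` and all `u, v` with `⟪φ, k u⟫, ⟪φ, k v⟫ ≥ δ`:
  `|⟪Aⁿ k_u, M Aⁿ k_v⟫ / ⟪Aⁿ k_u, M₁ Aⁿ k_v⟫ - ⟪φ, Mφ⟫/⟪φ, M₁φ⟫| < ε`.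

Use (one-dimensional lattice models): with `A` the transfer operator on `L²` of the one-site a priori
measure, `k_u = K(u, ·)` its kernel sections (`Literature.Analysis.OperatorTheory.exists_transferOperator`,
`memLp_kernel_section`), `M` the integral operator of a bulk observable inserted between two blocks
of `n` sites and `M₁` the same without the observable, the ratio is the finite-volume Gibbs
expectation of the observable with boundary spins `u, v` at distance `n`; the theorem says it becomes
independent of the boundary condition, uniformly on the sets where `⟪φ, k_u⟫` is bounded below
(compact sets of boundary spins) — the analytic core of uniqueness of the shift-invariant Gibbs state
(Cassandro–Olivieri–Pellegrinotti–Presutti 1978 for unbounded spins; Georgii 2011, Ch. 10–11).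
[folklore]
-/

noncomputable section

open Filter Topology
open scoped RealInnerProductSpace

namespace Literature.Analysis.OperatorTheory

variable {E : Type*} [NormedAddCommGroup E] [InnerProductSpace ℝ E]

/-- Bilinear bookkeeping: `|⟪x, My⟫ - ⟪x', My'⟫| ≤ ‖M‖ (‖x - x'‖ ‖y‖ + ‖x'‖ ‖y - y'‖)`. [folklore] -/
theorem abs_inner_apply_sub_inner_apply_le (M : E →L[ℝ] E) (x x' y y' : E) :
    |⟪x, M y⟫ - ⟪x', M y'⟫| ≤ ‖M‖ * (‖x - x'‖ * ‖y‖ + ‖x'‖ * ‖y - y'‖) := by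
  have h : ⟪x, M y⟫ - ⟪x', M y'⟫ = ⟪x - x', M y⟫ + ⟪x', M (y - y')⟫ := by
    rw [inner_sub_left, map_sub, inner_sub_right]; ring
  rw [h]
  refine (abs_add_le _ _).trans ?_
  have h1 : |⟪x - x', M y⟫| ≤ ‖M‖ * (‖x - x'‖ * ‖y‖) := by
    calc |⟪x - x', M y⟫| ≤ ‖x - x'‖ * ‖M y‖ := abs_real_inner_le_norm _ _
      _ ≤ ‖x - x'‖ * (‖M‖ * ‖y‖) := by gcongr; exact M.le_opNorm y
      _ = ‖M‖ * (‖x - x'‖ * ‖y‖) := by ring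
  have h2 : |⟪x', M (y - y')⟫| ≤ ‖M‖ * (‖x'‖ * ‖y - y'‖) := by
    calc |⟪x', M (y - y')⟫| ≤ ‖x'‖ * ‖M (y - y')‖ := abs_real_inner_le_norm _ _
      _ ≤ ‖x'‖ * (‖M‖ * ‖y - y'‖) := by gcongr; exact M.le_opNorm _
      _ = ‖M‖ * (‖x'‖ * ‖y - y'‖) := by ring
  calc |⟪x - x', M y⟫| + |⟪x', M (y - y')⟫|
      ≤ ‖M‖ * (‖x - x'‖ * ‖y‖) + ‖M‖ * (‖x'‖ * ‖y - y'‖) := add_le_add h1 h2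
    _ = ‖M‖ * (‖x - x'‖ * ‖y‖ + ‖x'‖ * ‖y - y'‖) := by ring

omit [InnerProductSpace ℝ E] [NormedAddCommGroup E] in
/-- Ratio bookkeeping: for `b > 0` and `|e₂| ≤ b/2`,
`|(a + e₁)/(b + e₂) - a/b| ≤ 2 (|e₁| + (|a|/b) |e₂|) / b`. [folklore] -/
theorem abs_add_div_add_sub_div_le {a b e₁ e₂ : ℝ} (hb : 0 < b) (he₂ : |e₂| ≤ b / 2) :
    |(a + e₁) / (b + e₂) - a / b| ≤ 2 * (|e₁| + |a| / b * |e₂|) / b := by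
  have hbe : b / 2 ≤ b + e₂ := by have := neg_abs_le e₂; linarith
  have hbe0 : 0 < b + e₂ := by linarith
  have heq : (a + e₁) / (b + e₂) - a / b = (b * e₁ - a * e₂) / (b * (b + e₂)) := by
    field_simp
    ring
  rw [heq, abs_div, abs_of_pos (mul_pos hb hbe0)]
  have hnum : |b * e₁ - a * e₂| ≤ b * |e₁| + |a| * |e₂| := by
    calc |b * e₁ - a * e₂| ≤ |b * e₁| + |a * e₂| := abs_sub _ _
      _ = b * |e₁| + |a| * |e₂| := by rw [abs_mul, abs_mul, abs_of_pos hb]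
  calc |b * e₁ - a * e₂| / (b * (b + e₂)) ≤ (b * |e₁| + |a| * |e₂|) / (b * (b / 2)) := by
        gcongr
    _ = 2 * (|e₁| + |a| / b * |e₂|) / b := by
        field_simp

/-- **Uniform convergence of transfer-operator ratios under power iteration with a gap.** Let `A` be
a bounded operator on a real inner product space whose powers converge to a rank-one map at a
geometric rate, `‖Aⁿ g - λ₀ⁿ ⟪φ, g⟫ φ‖ ≤ θⁿ ‖g‖` with `0 ≤ θ < λ₀` (e.g. a compact self-adjoint
positivity improving operator, `IsPositivityImproving.exists_norm_pow_sub_le`), let `k : X → E` be a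
bounded family (`‖k u‖ ≤ R`; the kernel sections `k_u = K(u, ·)` of a transfer operator) and `M, M₁`
bounded operators with `⟪φ, M₁ φ⟫ > 0`. Then the ratios
`⟪Aⁿ k_u, M Aⁿ k_v⟫ / ⟪Aⁿ k_u, M₁ Aⁿ k_v⟫` converge to `⟪φ, Mφ⟫ / ⟪φ, M₁φ⟫` as `n → ∞`, UNIFORMLY in
`(u, v)` on every set `{⟪φ, k_u⟫ ≥ δ, ⟪φ, k_v⟫ ≥ δ}`, `δ > 0` — the mechanism behind the independence
of bulk Gibbs expectations from far-away boundary conditions in one-dimensional models (numerator and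
denominator both behave like `λ₀^{2n} ⟪φ, k_u⟫ ⟪φ, k_v⟫ ⟪φ, (·) φ⟫`). [folklore] -/
theorem exists_forall_abs_ratio_sub_lt {A M M₁ : E →L[ℝ] E} {φ : E} {lam₀ θ R : ℝ}
    (hlam : 0 < lam₀) (hθ0 : 0 ≤ θ) (hθ : θ < lam₀)
    (hpow : ∀ (n : ℕ) (g : E), ‖(A ^ n) g - (lam₀ ^ n * ⟪φ, g⟫) • φ‖ ≤ θ ^ n * ‖g‖)
    {X : Type*} {k : X → E} (hk : ∀ u, ‖k u‖ ≤ R) (hM₁ : 0 < ⟪φ, M₁ φ⟫)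
    {δ : ℝ} (hδ : 0 < δ) {ε : ℝ} (hε : 0 < ε) :
    ∃ N₀ : ℕ, ∀ n : ℕ, N₀ ≤ n → ∀ u v : X, δ ≤ ⟪φ, k u⟫ → δ ≤ ⟪φ, k v⟫ →
      |⟪(A ^ n) (k u), M ((A ^ n) (k v))⟫ / ⟪(A ^ n) (k u), M₁ ((A ^ n) (k v))⟫ -
        ⟪φ, M φ⟫ / ⟪φ, M₁ φ⟫| < ε := by
  -- constants
  set m₁ : ℝ := ⟪φ, M₁ φ⟫ with hm₁
  set a₀ : ℝ := ⟪φ, M φ⟫ with ha₀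
  set R' : ℝ := max R 0 with hR'
  have hR'0 : 0 ≤ R' := le_max_right _ _
  have hk' : ∀ u, ‖k u‖ ≤ R' := fun u => (hk u).trans (le_max_left _ _)
  set nφ : ℝ := ‖φ‖ with hnφ
  set r : ℝ := θ / lam₀ with hr
  have hr0 : 0 ≤ r := div_nonneg hθ0 hlam.le
  have hr1 : r < 1 := (div_lt_one hlam).2 hθ
  have hrn1 : ∀ n : ℕ, r ^ n ≤ 1 := fun n => pow_le_one₀ hr0 hr1.le
  set Cx : ℝ := R' * (1 + nφ ^ 2) with hCx
  have hCx0 : 0 ≤ Cx := by positivity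
  set C₁ : ℝ := 2 * ‖M‖ * R' * Cx with hC₁
  set C₂ : ℝ := 2 * ‖M₁‖ * R' * Cx with hC₂
  have hC₁0 : 0 ≤ C₁ := by positivity
  have hC₂0 : 0 ≤ C₂ := by positivity
  set b₀ : ℝ := δ ^ 2 * m₁ with hb₀
  have hb₀0 : 0 < b₀ := by positivity
  set ρ : ℝ := |a₀| / m₁ with hρ
  have hρ0 : 0 ≤ ρ := by positivity
  -- the normalised iterates and their convergence
  set x : ℕ → X → E := fun n u => (lam₀ ^ n)⁻¹ • (A ^ n) (k u) with hx
  have hlamn : ∀ n : ℕ, 0 < lam₀ ^ n := fun n => pow_pos hlam n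
  have hAx : ∀ n u, (A ^ n) (k u) = lam₀ ^ n • x n u := fun n u => by
    rw [hx]; dsimp only; rw [smul_smul, mul_inv_cancel₀ (hlamn n).ne', one_smul]
  have hconv : ∀ n u, ‖x n u - ⟪φ, k u⟫ • φ‖ ≤ r ^ n * R' := by
    intro n u
    have h1 : x n u - ⟪φ, k u⟫ • φ =
        (lam₀ ^ n)⁻¹ • ((A ^ n) (k u) - (lam₀ ^ n * ⟪φ, k u⟫) • φ) := by
      rw [smul_sub, smul_smul, ← mul_assoc, inv_mul_cancel₀ (hlamn n).ne', one_mul]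
    rw [h1, norm_smul, norm_inv, norm_pow, Real.norm_of_nonneg hlam.le]
    calc (lam₀ ^ n)⁻¹ * ‖(A ^ n) (k u) - (lam₀ ^ n * ⟪φ, k u⟫) • φ‖
        ≤ (lam₀ ^ n)⁻¹ * (θ ^ n * R') := by
          gcongr
          · exact (hpow n (k u)).trans (by gcongr; exact hk' u)
      _ = r ^ n * R' := by rw [hr, div_pow]; field_simp
  -- a priori bounds
  have hc : ∀ u, |⟪φ, k u⟫| ≤ nφ * R' := fun u =>
    (abs_real_inner_le_norm _ _).trans (by rw [hnφ]; gcongr; exact hk' u)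
  have hcφ : ∀ u, ‖⟪φ, k u⟫ • φ‖ ≤ Cx := fun u => by
    rw [norm_smul, Real.norm_eq_abs]
    calc |⟪φ, k u⟫| * ‖φ‖ ≤ nφ * R' * nφ := by gcongr; exact hc u
      _ = R' * nφ ^ 2 := by ring
      _ ≤ Cx := by rw [hCx]; nlinarith [sq_nonneg nφ]
  have hxb : ∀ n u, ‖x n u‖ ≤ Cx := fun n u => by
    calc ‖x n u‖ = ‖(x n u - ⟪φ, k u⟫ • φ) + ⟪φ, k u⟫ • φ‖ := by rw [sub_add_cancel]
      _ ≤ ‖x n u - ⟪φ, k u⟫ • φ‖ + ‖⟪φ, k u⟫ • φ‖ := norm_add_le _ _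
      _ ≤ r ^ n * R' + R' * nφ ^ 2 := by
          gcongr
          · exact hconv n u
          · rw [norm_smul, Real.norm_eq_abs]
            calc |⟪φ, k u⟫| * ‖φ‖ ≤ nφ * R' * nφ := by gcongr; exact hc u
              _ = R' * nφ ^ 2 := by ring
      _ ≤ 1 * R' + R' * nφ ^ 2 := by gcongr; exact hrn1 n
      _ = Cx := by rw [hCx]; ring
  -- the errors
  have herr : ∀ (L : E →L[ℝ] E) (n : ℕ) (u v : X),
      |⟪x n u, L (x n v)⟫ - ⟪φ, k u⟫ * ⟪φ, k v⟫ * ⟪φ, L φ⟫| ≤ r ^ n * (2 * ‖L‖ * R' * Cx) := by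
    intro L n u v
    have h1 : ⟪φ, k u⟫ * ⟪φ, k v⟫ * ⟪φ, L φ⟫ = ⟪⟪φ, k u⟫ • φ, L (⟪φ, k v⟫ • φ)⟫ := by
      rw [map_smul, real_inner_smul_left, real_inner_smul_right]; ring
    rw [h1]
    calc |⟪x n u, L (x n v)⟫ - ⟪⟪φ, k u⟫ • φ, L (⟪φ, k v⟫ • φ)⟫|
        ≤ ‖L‖ * (‖x n u - ⟪φ, k u⟫ • φ‖ * ‖x n v‖ + ‖⟪φ, k u⟫ • φ‖ * ‖x n v - ⟪φ, k v⟫ • φ‖) :=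
          abs_inner_apply_sub_inner_apply_le L _ _ _ _
      _ ≤ ‖L‖ * (r ^ n * R' * Cx + Cx * (r ^ n * R')) := by
          gcongr
          · exact hconv n u
          · exact hxb n v
          · exact hcφ u
          · exact hconv n v
      _ = r ^ n * (2 * ‖L‖ * R' * Cx) := by ring
  -- choice of `N₀` from `rⁿ → 0`
  have htend : Tendsto (fun n : ℕ => r ^ n) atTop (𝓝 0) :=
    tendsto_pow_atTop_nhds_zero_of_lt_one hr0 hr1
  set τ : ℝ := min (b₀ / 2 / (C₂ + 1)) (ε * b₀ / (2 * (C₁ + ρ * C₂) + 1)) with hτ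
  have hτ0 : 0 < τ := lt_min (by positivity) (by positivity)
  obtain ⟨N₀, hN₀⟩ := eventually_atTop.1 (htend.eventually (gt_mem_nhds hτ0))
  refine ⟨N₀, fun n hn u v hu hv => ?_⟩
  have hrn : r ^ n < τ := hN₀ n hn
  have hrn0 : 0 ≤ r ^ n := pow_nonneg hr0 n
  have hcu : 0 < ⟪φ, k u⟫ := hδ.trans_le hu
  have hcv : 0 < ⟪φ, k v⟫ := hδ.trans_le hv
  -- pass to normalised iterates
  have hratio : ⟪(A ^ n) (k u), M ((A ^ n) (k v))⟫ / ⟪(A ^ n) (k u), M₁ ((A ^ n) (k v))⟫ =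
      ⟪x n u, M (x n v)⟫ / ⟪x n u, M₁ (x n v)⟫ := by
    rw [hAx n u, hAx n v]
    simp only [map_smul, real_inner_smul_left, real_inner_smul_right]
    rw [← mul_assoc, ← mul_assoc, mul_div_mul_left _ _ (mul_ne_zero (hlamn n).ne' (hlamn n).ne')]
  rw [hratio]
  -- the target ratio with the `c`'s put back
  set cc : ℝ := ⟪φ, k u⟫ * ⟪φ, k v⟫ with hcc
  have hcc0 : 0 < cc := mul_pos hcu hcv
  have hccδ : δ ^ 2 ≤ cc := by rw [hcc, sq]; exact mul_le_mul hu hv hδ.le hcu.le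
  have htarget : ⟪φ, M φ⟫ / ⟪φ, M₁ φ⟫ = (cc * a₀) / (cc * m₁) := by
    rw [mul_div_mul_left _ _ hcc0.ne']
  rw [htarget]
  set e₁ : ℝ := ⟪x n u, M (x n v)⟫ - cc * a₀ with he₁
  set e₂ : ℝ := ⟪x n u, M₁ (x n v)⟫ - cc * m₁ with he₂
  have he₁b : |e₁| ≤ r ^ n * C₁ := by rw [he₁, hcc]; exact herr M n u v
  have he₂b : |e₂| ≤ r ^ n * C₂ := by rw [he₂, hcc]; exact herr M₁ n u v
  have hN : ⟪x n u, M (x n v)⟫ = cc * a₀ + e₁ := by rw [he₁]; ring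
  have hD : ⟪x n u, M₁ (x n v)⟫ = cc * m₁ + e₂ := by rw [he₂]; ring
  rw [hN, hD]
  have hb : b₀ ≤ cc * m₁ := by rw [hb₀]; exact mul_le_mul_of_nonneg_right hccδ hM₁.le
  have hbpos : 0 < cc * m₁ := hb₀0.trans_le hb
  -- `|e₂| ≤ b/2`
  have hτ1 : τ ≤ b₀ / 2 / (C₂ + 1) := min_le_left _ _
  have hτ2 : τ ≤ ε * b₀ / (2 * (C₁ + ρ * C₂) + 1) := min_le_right _ _
  have he₂half : |e₂| ≤ cc * m₁ / 2 := by
    calc |e₂| ≤ r ^ n * C₂ := he₂b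
      _ ≤ r ^ n * (C₂ + 1) := by gcongr; linarith
      _ ≤ τ * (C₂ + 1) := by gcongr
      _ ≤ b₀ / 2 / (C₂ + 1) * (C₂ + 1) := by gcongr
      _ = b₀ / 2 := by field_simp
      _ ≤ cc * m₁ / 2 := by linarith
  have hmain := abs_add_div_add_sub_div_le (a := cc * a₀) (e₁ := e₁) hbpos he₂half
  refine hmain.trans_lt ?_
  -- `|a|/b = ρ`
  have hab : |cc * a₀| / (cc * m₁) = ρ := by
    rw [abs_mul, abs_of_pos hcc0, hρ, mul_div_mul_left _ _ hcc0.ne']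
  rw [hab]
  calc 2 * (|e₁| + ρ * |e₂|) / (cc * m₁) ≤ 2 * (r ^ n * C₁ + ρ * (r ^ n * C₂)) / b₀ := by
        gcongr
    _ = r ^ n * (2 * (C₁ + ρ * C₂)) / b₀ := by ring
    _ ≤ r ^ n * (2 * (C₁ + ρ * C₂) + 1) / b₀ := by gcongr; linarith
    _ < τ * (2 * (C₁ + ρ * C₂) + 1) / b₀ := by gcongr
    _ ≤ ε * b₀ / (2 * (C₁ + ρ * C₂) + 1) * (2 * (C₁ + ρ * C₂) + 1) / b₀ := by gcongr
    _ = ε := by field_simp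

end Literature.Analysis.OperatorTheory

end
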